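import Literature.AlgebraicGeometry.Frobenioids.Prop55SubRatStdRlfClosers
import Literature.AlgebraicGeometry.Frobenioids.Prop55SubStandardHolds
import HarnessLib

/-!
# Frobenioids I, Proposition 5.5 (iii), "Finally" (rationally standard type) — the repaired slot
# closed MODULO (K) alone: the realification inputs (H) and (N) DISCHARGED

Mochizuki, *The geometry of Frobenioids I: the general theory*, Kyushu J. Math. **62** (2008)
293–400, §5, Proposition 5.5 (iii) p. 104 ll. 37–39 ("Finally, if, moreover, `C` is not of group-like
type, then if `C` is of standard (respectively, rationally standard) type, then so are `C^un-tr`,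
`C^rlf`"), proof p. 105 ll. 20–27. [cite: MochizukiFrdI2008, Prop. 5.5 (iii) p.104]

Proof-only appendix (cell abc-iut, sub-DAG S7 row `FrdI:Prop5.5(iii)/P55-L07`, rationally standard half,
seat abc-iut-w5-d250) to `Prop55SubRatStdRlfClosers.lean`: of the three named inputs of
`FrdI.Prop55Sub.prop55iii_untr_rlf_ratStd'_of` —
(H) the Thm. 5.2 standing hypotheses for THE realified data `(Φ^rlf, ℝ · Φ^birat)`,
(N) "`Φ` non-dilating ⇒ `Φ^rlf` non-dilating",
(K) "`((C^rlf)^un-tr)^birat` admits a Frobenius-compact object" —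
the first two are no longer needed: the `C^rlf`-is-of-standard-type step is now the UNCONDITIONAL theorem
`PreFrobenioid.isOfStandardType_rlf_of_isOfStandardType` (seat abc-iut-w4-d084,
`Prop55SubStandardHolds.lean`: Thm. 5.2 (iii) right to left for the model category of
`(Φ^rlf, ℝ · Φ^birat)` through `ModelFrobenioid.data_isOfStandardType_of`, which needs only `Φ^rlf` sharp,
`ℝ · Φ^birat` group-like and `D` totally epimorphic; (N) is `isNonDilatingOn_rlfFunctor`,
`RealificationNonDilating.lean`). Hence:
* `FrdI.Prop55Sub.prop55iii_untr_rlf_ratStd'_of_frobCompact` — the repaired slot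
  `Prop55iii_untr_rlf_ratStd' F hF hΦ` MODULO (K) ALONE (a hypothesis BY NAME, stated exactly as in
  `prop55iii_untr_rlf_ratStd'_of`; sub-DAG row P55-L07c/K of the cell, print p. 105 ll. 20–22
  "since `(C^un-tr)^birat` admits a Frobenius-compact object, so does `(C^rlf)^birat`"): the `C^un-tr`
  conjunct is unconditional (`prop55iii_untr_ratStd_of`); for `C^rlf`, Def. 4.5 (iii): birationally
  Frobenius-normalized (`rlf_isOfBiratFrobeniusNormalizedType`, seat abc-iut-L1-d2), rational
  (`isRational_rlf_of`), standard (`isOfStandardType_rlf_of_isOfStandardType`), (b) = (K);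
* `FrdI.Prop55Sub.isOfRationallyStandardType_rlf_of_frobCompact` — the same `C^rlf` conjunct for ONE
  given Frobenioid structure `hR` on `C^rlf → F_{Φ^rlf}` and ONE given Frobenius-compact object of
  `((C^rlf)^un-tr)^birat` (the form a constructor of such an object plugs into directly).
No statement of the paper is strengthened (hypotheses only removed); nothing here bears on
[IUTchIII] Cor. 3.12.
-/

noncomputable section

namespace Literature.AlgebraicGeometry.Frobenioids

open CategoryTheory Opposite

universe w v v' u u'

namespace FrdI.Prop55Sub

open PreFrobenioid PreFrobenioidData
open Literature.AnabelianGeometry.EtaleTheta (rlfFunctor)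

variable {D : Type u} [Category.{v} D] {Φ : Dᵒᵖ ⥤ CommMonCat.{w}}
  {C : Type u'} [Category.{v'} C] (F : C ⥤ ElemFrobenioid Φ)

/-- **The `C^rlf` conjunct of Prop. 5.5 (iii), "Finally", rationally standard type, at ONE Frobenius-compact
object**: for a Frobenioid `C → F_Φ` over a perf-factorial `Φ`, NOT of group-like type and of rationally
standard type (THE parameters, support predicate `PrimarySupp`), and a Frobenioid structure `hR` on THE
realification `C^rlf → F_{Φ^rlf}`, any Frobenius-compact object `Y` of `((C^rlf)^un-tr)^birat` witnesses that
`C^rlf` is of rationally standard type: Def. 4.5 (iii) clause by clause — birationally Frobenius-normalized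
(seat abc-iut-L1-d2), rational (`isRational_rlf_of`), standard (seat abc-iut-w4-d084's unconditional
`isOfStandardType_rlf_of_isOfStandardType`), (b) = `Y`. [cite: MochizukiFrdI2008, Prop. 5.5 (iii) p.104] -/
theorem isOfRationallyStandardType_rlf_of_frobCompact (hF : IsFrobenioid F) (hΦ : IsPerfFactorialOn Φ)
    (hng : ¬ IsOfType (IsGroupLikeObj F))
    (h : (PreFrobenioidData.ofFunctor Φ F).IsOfRationallyStandardType
      (rsParams hF fun a 𝔭 => PrimarySupp a 𝔭))
    (hR : IsFrobenioid (rlfToElem F hΦ))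
    (Y : Birat (untrFunctor hR) (isFrobenioid_untr hR) (hasBiratSquares_untr hR))
    (hY : (PreFrobenioidData.ofFunctor (zeroMonoid D)
      (Birat.toElemZero (isFrobenioid_untr hR) (hasBiratSquares_untr hR))).IsFrobeniusCompact Y) :
    (PreFrobenioidData.ofFunctor _ (rlfToElem F hΦ)).IsOfRationallyStandardType
      (rsParams hR fun a 𝔭 => PrimarySupp a 𝔭) :=
  { biratFrobNormalized := rlf_isOfBiratFrobeniusNormalizedType F hΦ hR
    rational := isRational_rlf_of hF hΦ hR h.rational
    standard := isOfStandardType_rlf_of_isOfStandardType F hF hΦ hng h.standard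
    frobCompact := ⟨Y, hY⟩ }

/-- **Proposition 5.5 (iii), "Finally", rationally standard type — the repaired slot
`Prop55iii_untr_rlf_ratStd'` CLOSED MODULO (K) ALONE** ("`((C^rlf)^un-tr)^birat` admits a Frobenius-compact
object", print p. 105 ll. 20–22; a hypothesis BY NAME, not a fact of the tree — sub-DAG row P55-L07c/K):
the realification inputs (H) (Thm. 5.2 standing hypotheses for the realified data) and (N) ("`Φ`
non-dilating ⇒ `Φ^rlf` non-dilating") of `prop55iii_untr_rlf_ratStd'_of` are DISCHARGED — the standard-type
step for `C^rlf` is seat abc-iut-w4-d084's unconditional `isOfStandardType_rlf_of_isOfStandardType`. The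
`C^un-tr` conjunct is unconditional (`prop55iii_untr_ratStd_of`). The slot's antecedents "Frobenius-isotropic /
Frobenius-normalized type" are not used. [cite: MochizukiFrdI2008, Prop. 5.5 (iii) p.104] -/
theorem prop55iii_untr_rlf_ratStd'_of_frobCompact (hF : IsFrobenioid F) (hΦ : IsPerfFactorialOn Φ)
    (hK : ∀ hR : IsFrobenioid (rlfToElem F hΦ),
      ∃ Y : Birat (untrFunctor hR) (isFrobenioid_untr hR) (hasBiratSquares_untr hR),
        (PreFrobenioidData.ofFunctor (zeroMonoid D)
          (Birat.toElemZero (isFrobenioid_untr hR) (hasBiratSquares_untr hR))).IsFrobeniusCompact Y) :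
    Prop55iii_untr_rlf_ratStd' F hF hΦ := by
  intro _ _ hng h
  refine ⟨prop55iii_untr_ratStd_of F hF _ hng h, fun hR => ?_⟩
  obtain ⟨Y, hY⟩ := hK hR
  exact isOfRationallyStandardType_rlf_of_frobCompact F hF hΦ hng h hR Y hY

end FrdI.Prop55Sub

end Literature.AlgebraicGeometry.Frobenioids

end
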